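import Summits.CriticalPhenomena.Ising3DConformalLimit.Theses.InverseSquareTelemetry
import Summits.CriticalPhenomena.Ising3DConformalLimit.Theorems.InverseSquareTelemetryPositiveSolutionAsymptotics
import Summits.CriticalPhenomena.Ising3DConformalLimit.Theorems.InverseSquareTelemetryPositiveSolutionAsymptoticsGreenIdentity
import Summits.CriticalPhenomena.Ising3DConformalLimit.Theorems.InverseSquareTelemetryPositiveSolutionAsymptoticsGreenModulation
import Summits.CriticalPhenomena.Ising3DConformalLimit.Theorems.InverseSquareTelemetryPositiveSolutionAsymptoticsSubProfile
import Summits.CriticalPhenomena.Ising3DConformalLimit.Theorems.InverseSquareTelemetryPositiveSolutionAsymptoticsSuperProfile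
import Summits.CriticalPhenomena.Ising3DConformalLimit.Theorems.InverseSquareTelemetryPositiveSolutionAsymptoticsBallHarnack
import Summits.CriticalPhenomena.Ising3DConformalLimit.Theorems.InverseSquareTelemetryPositiveSolutionAsymptoticsBallAssembly
import Literature.Probability.LatticeModels.LatticeGreenAsymptotics
import Literature.Probability.LatticeModels.LatticeGreenPoisson
import Literature.Probability.LatticeModels.LatticeGreenPositive
import HarnessLib

/-!
# Crux `InverseSquareTelemetry.PositiveSolutionAsymptotics` (stmt-CriticalPhenomena-4496) — PROVED

THEOREM-ONLY file closing the statement item stmt-CriticalPhenomena-4496 of route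
`CriticalPhenomena/Ising3DConformalLimit/InverseSquareTelemetry` (line `registered`, lead c3).

The crux (lattice Agmon–Murata–Pinchover asymptotics on `ℤ³` with Dini rate): every positive solution
`u` of `Δ_{ℤ³} u = V u` on `{|x|₂ ≥ R}` with `| |x|₂² V(x) − κ | ≤ C |x|₂^{−ε}` (`κ ≥ 0`, `ε > 0`) and
`u → 0` (cofinite) satisfies `u(x) |x|₂^{α₊} → c > 0`, `α₊ = (1 + √(1+4κ))/2`.

## Assembly (everything below is proved in the tree; no named fact is used)

* S1 `stub_aprioriBounds` (barriers + `h`-transform maximum principle on exterior regions),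
  S3 `stub_annulusSqueeze` (two-annulus squeeze), and the composition
  `of_bounds_blowDown_squeeze : S1 → S2 → S3 → crux`.
* S2 (blow-down constant) = `stub_blowDownOfBallHarnack` applied to T1 `stub_shellMonotone`
  (shell monotonicity), `schrodingerHarnack` (below), P `stub_propagateBall` (one Harnack step with
  `w = Q'·H - u`), T3 `stub_localComparison` (local `(Δ-V)`-harmonic comparison function
  `H ≈ |x|^{-α₊}`), T4 `stub_annulusChain` (chains in lattice annuli).
* `schrodingerHarnack` — **the Schrödinger–Harnack inequality on remote balls of `ℤ³`**: there are
  `c₀ > 0`, `C ≥ 1`, `R₀` such that for `R ≥ R₀`, every centre `x₀`, every potential with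
  `|V| ≤ c₀/R²` on the lattice ball `B(x₀,R)` and every `w ≥ 0` on `B ∪ ∂B` solving `Δw = Vw` on `B`,
  `w x ≤ C w y` on the core `B(x₀, R/16)`. It replaces the elliptic Harnack inequality for uniformly
  elliptic conductances (the named fact `Literature.Probability.LatticeModels.conductanceHarnackZ3`,
  Barlow 2017 Thm 7.19) used by the c2 assembly, and is proved by Green-function comparison from the
  tree's `latticeGreen_asymptotics` (`latticeGreen/2 = a₀/|x| + O(|x|⁻³)`, `Δ(latticeGreen/2) = -δ₀`):
  H2 `stub_greenModulation` (`6G + 2Σᵢ zᵢ(G(z+eᵢ) - G(z-eᵢ)) ≍ 2a₀/|z|`), H3 `stub_subProfile` /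
  `stub_superProfile` (the profiles `G·(β ± |·|²/(4R²)) ∓ (λ/R²)Ξ` are sub/super-solutions of `Δ - V`
  with a unit pole whenever `R²|V| ≤ c₁`), H1 `stub_greenIdentity` (Green's second identity on finite
  subsets of `ℤ^d`), H4 `stub_harnackOfProfiles` (comparison of the `(Δ-V)`-Green functions of the
  ball with the profiles, maximum principle on the annulus, boundary representation of `w`).

References: Murata, Duke Math. J. 53 (1986); Pinchover, Duke Math. J. (1988); Keller–Pinchover–
Pogorzelski, J. Spectral Theory (2020); Lawler–Limic, *Random Walk: A Modern Introduction* (2010),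
Thm 4.3.1 (Green asymptotics) and §6.3 (Harnack); Lawler, *Intersections of Random Walks* (1991) §1.4–1.5.
-/

noncomputable section

namespace Summit.CriticalPhenomena.Ising3DConformalLimit.Theorems.PositiveSolutionAsymptotics

open Filter Topology Finset
open Literature.Probability.LatticeModels

/-- The free Green function `G₀ = latticeGreen/2` of `ℤ³` has the interface assumed by H2/H3 (`stub_greenModulation`, `stub_subProfile`, `stub_superProfile`):
harmonic off `0`, `ΔG₀(0) = -1`, positive, and `|G₀(x) - a₀/|x|| ≤ K/|x|³` with
`a₀ = Γ(1/2)/(4π^{3/2}) (= 1/(4π)) > 0` (`latticeGreen_asymptotics`). -/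
theorem halfGreen_interface :
    ∃ a₀ K : ℝ, 0 < a₀ ∧ 0 ≤ K ∧
      (∀ x : Literature.Probability.LatticeModels.Site 3, x ≠ 0 →
        Literature.Probability.LatticeModels.latticeLaplacianZd (fun z : Literature.Probability.LatticeModels.Site 3 => Literature.Probability.LatticeModels.latticeGreen z / 2) x = 0) ∧
      Literature.Probability.LatticeModels.latticeLaplacianZd (fun z : Literature.Probability.LatticeModels.Site 3 => Literature.Probability.LatticeModels.latticeGreen z / 2) 0 = -1 ∧
      (∀ x : Literature.Probability.LatticeModels.Site 3, 0 < Literature.Probability.LatticeModels.latticeGreen x / 2) ∧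
      (∀ x : Literature.Probability.LatticeModels.Site 3, x ≠ 0 →
        |Literature.Probability.LatticeModels.latticeGreen x / 2 - a₀ / Real.sqrt (∑ i, ((x i : ℤ) : ℝ) ^ 2)| ≤ K / Real.sqrt (∑ i, ((x i : ℤ) : ℝ) ^ 2) ^ 3) := by
  obtain ⟨K, hK⟩ := Literature.Probability.LatticeModels.latticeGreen_asymptotics (d := 3) le_rfl
  set a : ℝ := Real.Gamma ((3 : ℝ) / 2 - 1) / (2 * Real.pi ^ ((3 : ℝ) / 2)) with ha
  have ha0 : 0 < a := by
    rw [ha]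
    have h1 : 0 < Real.Gamma ((3 : ℝ) / 2 - 1) := Real.Gamma_pos_of_pos (by norm_num)
    positivity
  -- `K ≥ 0`: evaluate the asymptotic bound at `e₀`
  have hK0 : 0 ≤ K := by
    have h := hK (Pi.single 0 1) (by
      intro h0
      have := congrFun h0 0
      simp at this)
    have hn : Real.sqrt (∑ i, (((Pi.single (0 : Fin 3) (1 : ℤ) : Literature.Probability.LatticeModels.Site 3) i : ℤ) : ℝ) ^ 2) = 1 := by
      simp [Fin.sum_univ_three]
    rw [hn] at h
    simp only [Real.one_rpow, mul_one] at h
    exact le_trans (abs_nonneg _) h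
  refine ⟨a / 2, K / 2, by positivity, by positivity, ?_, ?_, ?_, ?_⟩
  · intro x hx
    have h := Literature.Probability.LatticeModels.latticeLaplacianZd_half_latticeGreen 3 le_rfl x
    rw [if_neg hx] at h
    rw [h]; norm_num
  · have h := Literature.Probability.LatticeModels.latticeLaplacianZd_half_latticeGreen 3 le_rfl (0 : Literature.Probability.LatticeModels.Site 3)
    rw [if_pos rfl] at h
    exact h
  · intro x
    exact half_pos (Literature.Probability.LatticeModels.latticeGreen_pos 3 le_rfl x)
  · intro x hx
    have h := hK x hx
    set r : ℝ := Real.sqrt (∑ i, ((x i : ℤ) : ℝ) ^ 2) with hr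
    have hr1 : 1 ≤ r := Literature.Probability.LatticeModels.one_le_sqrt_sum_sq_of_ne_zero hx
    have hr0 : 0 < r := by linarith
    have e1 : r ^ (2 - ((3 : ℕ) : ℝ)) = 1 / r := by
      rw [show (2 : ℝ) - ((3 : ℕ) : ℝ) = -1 by norm_num, Real.rpow_neg_one, one_div]
    have e2 : r ^ (-((3 : ℕ) : ℝ)) = 1 / r ^ 3 := by
      rw [Real.rpow_neg hr0.le, Real.rpow_natCast, one_div]
    rw [e1, e2] at h
    have e3 : Literature.Probability.LatticeModels.latticeGreen x / 2 - a / 2 / r =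
        (Literature.Probability.LatticeModels.latticeGreen x - a * (1 / r)) / 2 := by
      field_simp
    rw [e3, abs_div, abs_of_pos (by norm_num : (0 : ℝ) < 2), div_le_iff₀ (by norm_num : (0 : ℝ) < 2)]
    calc |Literature.Probability.LatticeModels.latticeGreen x - a * (1 / r)| ≤ K * (1 / r ^ 3) := h
      _ = K / 2 / r ^ 3 * 2 := by ring

/-- **`SH` — the Schrödinger–Harnack inequality on remote balls of `ℤ³`** (glue of H1 `stub_greenIdentity`,
H2 `stub_greenModulation`, H3∓ `stub_subProfile`/`stub_superProfile`, H4 `stub_harnackOfProfiles`): there are `c₀ > 0`, `C ≥ 1`, `R₀` such that for every `R ≥ R₀`, every centre `x₀`, every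
potential with `|V| ≤ c₀/R²` on the lattice ball `B(x₀,R)` and every `w ≥ 0` on `B(x₀,R) ∪ ∂B(x₀,R)` with
`Δw = Vw` on `B(x₀,R)`: `w x ≤ C · w y` for all `x, y ∈ B(x₀, R/16)`. -/
theorem schrodingerHarnack :
    ∃ c₀ : ℝ, 0 < c₀ ∧ ∃ C : ℝ, 1 ≤ C ∧ ∃ R₀ : ℝ, ∀ R : ℝ, R₀ ≤ R →
      ∀ (x₀ : Literature.Probability.LatticeModels.Site 3) (V w : Literature.Probability.LatticeModels.Site 3 → ℝ),
        (∀ z : Literature.Probability.LatticeModels.Site 3, Real.sqrt (∑ i, (((z i : ℤ) : ℝ) - ((x₀ i : ℤ) : ℝ)) ^ 2) ≤ R → |V z| ≤ c₀ / R ^ 2) →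
        (∀ z ∈ {z : Literature.Probability.LatticeModels.Site 3 | Real.sqrt (∑ i, (((z i : ℤ) : ℝ) - ((x₀ i : ℤ) : ℝ)) ^ 2) ≤ R} ∪ Literature.Probability.LatticeModels.zdOuterBoundary {z : Literature.Probability.LatticeModels.Site 3 | Real.sqrt (∑ i, (((z i : ℤ) : ℝ) - ((x₀ i : ℤ) : ℝ)) ^ 2) ≤ R}, 0 ≤ w z) →
        (∀ z : Literature.Probability.LatticeModels.Site 3, Real.sqrt (∑ i, (((z i : ℤ) : ℝ) - ((x₀ i : ℤ) : ℝ)) ^ 2) ≤ R →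
            Literature.Probability.LatticeModels.latticeLaplacianZd w z = V z * w z) →
        ∀ x y : Literature.Probability.LatticeModels.Site 3,
          Real.sqrt (∑ i, (((x i : ℤ) : ℝ) - ((x₀ i : ℤ) : ℝ)) ^ 2) ≤ R / 16 →
          Real.sqrt (∑ i, (((y i : ℤ) : ℝ) - ((x₀ i : ℤ) : ℝ)) ^ 2) ≤ R / 16 → w x ≤ C * w y := by
  obtain ⟨a₀, K, ha₀, hK, hG0, hG1, hGpos, hGasym⟩ := halfGreen_interface
  obtain ⟨r₃, hr₃, hmod⟩ := stub_greenModulation _ a₀ K ha₀ hK hGasym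
  exact stub_harnackOfProfiles a₀ ha₀
    (stub_subProfile _ a₀ K r₃ ha₀ hK hr₃ hG0 hG1 hGpos hGasym hmod)
    (stub_superProfile _ a₀ K r₃ ha₀ hK hr₃ hG0 hG1 hGpos hGasym hmod)
    (stub_greenIdentity 3)

/-- **S2 (blow-down constant), unconditionally**: `stub_blowDownOfBallHarnack` fed with T1
`stub_shellMonotone`, `schrodingerHarnack`, P `stub_propagateBall`, T3 `stub_localComparison`,
T4 `stub_annulusChain`. -/
theorem blowDownConstant :
    ∀ κ ε C : ℝ, 0 ≤ κ → 0 < ε → ∀ (u V : Literature.Probability.LatticeModels.Site 3 → ℝ) (R : ℝ), (∀ x : Literature.Probability.LatticeModels.Site 3, R ≤ Real.sqrt (∑ i, ((x i : ℝ)) ^ 2) → 0 < u x) → (∀ x : Literature.Probability.LatticeModels.Site 3, R ≤ Real.sqrt (∑ i, ((x i : ℝ)) ^ 2) → (∑ i : Fin 3, (u (x + Pi.single i 1) + u (x - Pi.single i 1))) - 6 * u x = V x * u x) → (∀ x : Literature.Probability.LatticeModels.Site 3, R ≤ Real.sqrt (∑ i, ((x i : ℝ)) ^ 2) → |(∑ i,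 ((x i : ℝ)) ^ 2) * V x - κ| ≤ C * Real.sqrt (∑ i, ((x i : ℝ)) ^ 2) ^ (-ε)) → Filter.Tendsto u Filter.cofinite (nhds 0) → ∀ m M : ℝ, 0 < m → (∀ᶠ x : Literature.Probability.LatticeModels.Site 3 in Filter.cofinite, m ≤ u x * Real.sqrt (∑ i, ((x i : ℝ)) ^ 2) ^ ((1 + Real.sqrt (1 + 4 * κ)) / 2) ∧ u x * Real.sqrt (∑ i, ((x i : ℝ)) ^ 2) ^ ((1 + Real.sqrt (1 + 4 * κ)) / 2) ≤ M) → ∃ c : ℝ, m ≤ c ∧ c ≤ M ∧ ∀ δ : ℝ, 0 < δ → ∀ ρ₀ : ℝ, ∃ ρ : ℝ, ρ₀ ≤ ρ ∧ ∀ x : Literature.Probability.LatticeModels.Site 3, ρ ≤ Real.sqrt (∑ i, ((x i : ℝ)) ^ 2) → Real.sqrt (∑ i, ((x i : ℝ)) ^ 2) ≤ 2 * ρ → |u x * Real.sqrt (∑ i, ((x i : ℝ)) ^ 2) ^ ((1 + Real.sqrt (1 + 4 * κ)) / 2) - c| ≤ δ :=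
  stub_blowDownOfBallHarnack stub_shellMonotone schrodingerHarnack stub_propagateBall
    stub_localComparison stub_annulusChain

end Summit.CriticalPhenomena.Ising3DConformalLimit.Theorems.PositiveSolutionAsymptotics

namespace Summit.CriticalPhenomena.Ising3DConformalLimit.Theorems

/-- **Crux `InverseSquareTelemetry.PositiveSolutionAsymptotics` (stmt-CriticalPhenomena-4496), proved.**
Lattice Agmon–Murata–Pinchover asymptotics on `ℤ³` with Dini rate: a positive solution of
`Δ_{ℤ³}u = Vu` on `{|x|₂ ≥ R}` with `| |x|₂²V(x) − κ | ≤ C|x|₂^{−ε}` and `u → 0` satisfies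
`u(x)|x|₂^{α₊} → c > 0`. Proof: S1 (a-priori bounds) → S2 (`PositiveSolutionAsymptotics.blowDownConstant`,
via the Schrödinger–Harnack inequality on remote balls) → S3 (annulus squeeze), composed by
`PositiveSolutionAsymptotics.of_bounds_blowDown_squeeze`. -/
theorem positiveSolutionAsymptotics_proof :
    Summit.CriticalPhenomena.Ising3DConformalLimit.Theses.InverseSquareTelemetry.PositiveSolutionAsymptotics :=
  PositiveSolutionAsymptotics.of_bounds_blowDown_squeeze PositiveSolutionAsymptotics.stub_aprioriBounds
    PositiveSolutionAsymptotics.blowDownConstant PositiveSolutionAsymptotics.stub_annulusSqueeze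

end Summit.CriticalPhenomena.Ising3DConformalLimit.Theorems
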